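import Summits.ValiantsHypothesis.ValiantsHypothesis.Theorems.LacunarySymmetroidMatrixDescartesDoorA26WallBubblingDoublyConfluentNondeg

/-!
# Wall bubbling for `DoorA26` — ONE WEYL PAIR ON A WALL (cases (a), (b)): NON-DEGENERACY of the confluent limit BY INERTIA

LINE / STUBS.  Crux `Theses.LacunarySymmetroid.DoorA26` (stmt-ValiantsHypothesis-19979; OPEN, typed, never asserted), line
`Cruxes/DoorA26/Lines/wall_bubbling.lean` (val-idea-15), obligation (W) `Stmt.stub_weylFaces`; statement file
`Cruxes/DoorA26/Lines/wall_bubbling_ConfluentDoor.lean` rev 4, stratum `Stmt.weylFaces_wall` with ONE Weyl pair `δ₀ = δ₅ = e₀` and one disjoint-type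
relation: (a) `e₁ + e₂ = e₃ + e₄` among the four non-Weyl values, (b) `e₀ + e₁ = e₂ + e₃` through the Weyl value (W1 #14 itemisation; W1 #13–#18
treated them per cluster in MEMBER currency).  Seat val-sym-door-p2 g13 (W1 #35); the one-pair companion of W1 #26/#26b–d.

THE POINT.  In W2's one-dslope frame (`…ConfluentLimit`, positions `0,5` confluent, `1,…,4` ordinary) the 21 slot functions are distinct at a GENERIC
face (W2 `slot_inj`); on the wall (a) the products `φ₁φ₂ = φ₃φ₄` coincide, on (b) `φ₀φ₁ = φ₂φ₃` — one coincidence each, with cancelling Gram pattern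
the disjoint pattern `E₁₂ − E₃₄` resp. `E₀₁ − E₂₃`, NOT realisable (W1 #13).  Hence (def-free, the master-lemma design of W1 #26 with ONE dslope):

* `onePair_classSums_of_det_zero` — integer model `vv : Fin 6 → ℕ`, degree `d = ![0,0,0,0,0,1]`, W2's `confluentDet_eq_quadForm`;
* `fiveA_model (![0,1,9,3,7])`, `onePairA_lonely`, `onePairA_special12_iff`; `fiveB_model (![0,4,1,3,9])`, `onePairB_lonely`, `onePairB_special01_iff`;
* **`confluentDet_ne_zero_of_polar_ne_zero_wallA`** (`hrel : δ0 1 + δ0 2 = δ0 3 + δ0 4`, `hgen`) and **`…_wallB`** (`hrel : δ0 0 + δ0 1 = δ0 2 + δ0 3`,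
  `hgen`): a symmetric frame with one non-zero polar Gram entry has a confluent determinant that is NOT identically zero.

USE: W1 #36 (`onePairLimit` #34 + these + W2's `multiplicity_transfer_iteratedDeriv` + W1 #12 `confluentDoor_conclusion_of_coincidence`) ⇒ the
single-cluster branch of `Stmt.weylFaces_wall` at ONE Weyl pair is DOOR-FREE; with W1 #28 (two pairs) the whole stratum's single-cluster branch is.
Nothing in this file bears on (W)/(M)/(R) themselves, on `DoorA26`, on `MatrixDescartes` (stmt-ValiantsHypothesis-18050) or on `VP ≠ VNP`;
registers unchanged.  `--supports stmt-ValiantsHypothesis-19979 --as helper`.  [this work] the inertia argument for the coinciding slot.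
-/

-- `Summit.ValiantsHypothesis.ValiantsHypothesis.…` repeats a component by the D-0017 layout
-- (single-conjunct summit), which the `dupNamespace` linter flags; the name is mandated.
set_option linter.dupNamespace false

namespace Summit.ValiantsHypothesis.ValiantsHypothesis.Theorems.LacunarySymmetroidMatrixDescartes.WallBubbling

open Finset Filter Topology Polynomial
open Bubbling (polar polar_comm polar_self extSum_card_zeros_le realisable_polarGram realisable_smul Realisable)
open SecondOrder (not_realisable_disjointPattern)
open scoped BigOperators

/-! ## 1. Class sums (one-dslope master lemma) -/

/-- **CLASS SUMS, one Weyl pair.**  Positions: the pair at `0,5` (`δ0 5 = δ0 0`), ordinary letters at `k.succ.castSucc`; `d = ![0,0,0,0,0,1]`.  If the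
pair-sum coincidences of the six frame exponents are modelled by `vv` and the confluent determinant of `W` vanishes identically, every SLOT-CLASS SUM
of the polar Gram vanishes. [this work] -/
theorem onePair_classSums_of_det_zero (δ0 : Fin 6 → ℝ) (h05 : δ0 5 = δ0 0)
    (vv : Fin 6 → ℕ) (hv : ∀ p q p₀ q₀ : Fin 6, δ0 p + δ0 q = δ0 p₀ + δ0 q₀ ↔ vv p + vv q = vv p₀ + vv q₀)
    (d : Fin 6 → ℕ) (hd : d = ![0, 0, 0, 0, 0, 1])
    (W : Fin 6 → Matrix (Fin 2) (Fin 2) ℝ)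
    (hall : ∀ t : ℝ, ((Real.exp (δ0 0 * t)) • (W 0 + t • W 5) + ∑ k : Fin 4, (Real.exp (δ0 k.succ.castSucc * t)) • W k.succ.castSucc).det = 0) :
    ∀ p₀ q₀ : Fin 6, (∑ p : Fin 6, ∑ q : Fin 6,
      if (vv p + vv q = vv p₀ + vv q₀ ∧ d p + d q = d p₀ + d q₀) then polar (W p) (W q) else 0) = 0 := by
  classical
  have hdg5 : d 5 = 1 := by rw [hd]; decide
  have hdglt : ∀ l : Fin 6, l ≠ 5 → d l = 0 := by rw [hd]; decide
  have hslot : ∀ (p : Fin 6) (t : ℝ), (if p = 5 then dslope (fun y : ℝ => Real.exp (y * t)) (δ0 0) (δ0 0) else Real.exp (δ0 p * t))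
        = t ^ d p * Real.exp (δ0 p * t) := by
    intro p t
    by_cases hp5 : p = 5
    · subst hp5; rw [if_pos rfl, dslope_exp_same, hdg5, pow_one, h05]
    · rw [if_neg hp5, hdglt p hp5, pow_zero, one_mul]
  set F : Finset ℝ := (univ : Finset (Fin 6 × Fin 6)).image (fun pr => δ0 pr.1 + δ0 pr.2) with hF
  have hmemF : ∀ p q : Fin 6, δ0 p + δ0 q ∈ F := fun p q =>
    Finset.mem_image.mpr ⟨(p, q), Finset.mem_univ _, rfl⟩
  set P : ℝ → ℝ[X] := fun w => ∑ p : Fin 6, ∑ q : Fin 6,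
    if δ0 p + δ0 q = w then C (polar (W p) (W q)) * X ^ (d p + d q) else 0 with hP
  have hrep : ∀ t : ℝ, ∑ w ∈ F, (P w).eval t * Real.exp (w * t) = 0 := by
    intro t
    have hlim := hall t
    rw [confluentDet_eq_quadForm] at hlim
    rw [← hlim]
    have h1 : ∀ w ∈ F, (P w).eval t * Real.exp (w * t)
        = ∑ p : Fin 6, ∑ q : Fin 6, if δ0 p + δ0 q = w then
            polar (W p) (W q) * t ^ (d p + d q) * Real.exp (w * t) else 0 := by
      intro w _
      rw [hP]
      simp only [eval_finsetSum, Finset.sum_mul]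
      refine Finset.sum_congr rfl fun p _ => Finset.sum_congr rfl fun q _ => ?_
      by_cases hval : δ0 p + δ0 q = w
      · rw [if_pos hval, if_pos hval, eval_mul, eval_C, eval_pow, eval_X]
      · rw [if_neg hval, if_neg hval, eval_zero, zero_mul]
    rw [Finset.sum_congr rfl h1, Finset.sum_comm]
    refine Finset.sum_congr rfl fun p _ => ?_
    rw [Finset.sum_comm]
    refine Finset.sum_congr rfl fun q _ => ?_
    rw [Finset.sum_ite_eq F (δ0 p + δ0 q), if_pos (hmemF p q), hslot p t, hslot q t]
    rw [show (δ0 p + δ0 q) * t = δ0 p * t + δ0 q * t by ring, Real.exp_add, pow_add]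
    ring
  have hdgle : ∀ l : Fin 6, d l ≤ 1 := by rw [hd]; decide
  have hdegP : ∀ w, (P w).natDegree ≤ 2 := by
    intro w
    rw [hP]
    refine natDegree_sum_le_of_forall_le _ _ fun p _ => natDegree_sum_le_of_forall_le _ _ fun q _ => ?_
    by_cases hval : δ0 p + δ0 q = w
    · rw [if_pos hval]
      refine (natDegree_C_mul_X_pow_le _ _).trans ?_
      have := hdgle p; have := hdgle q; omega
    · rw [if_neg hval, natDegree_zero]; exact Nat.zero_le _
  have hPzero : ∀ w ∈ F, P w = 0 := by
    by_contra hne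
    push Not at hne
    have hslots : (∑ w ∈ F, if P w = 0 then 0 else (P w).natDegree + 1) ≤ 3 * F.card + 1 := by
      have h1 : (∑ w ∈ F, if P w = 0 then 0 else (P w).natDegree + 1) ≤ ∑ w ∈ F, 3 := by
        refine Finset.sum_le_sum fun w _ => ?_
        have := hdegP w
        split_ifs <;> omega
      rw [Finset.sum_const, smul_eq_mul] at h1
      linarith [h1]
    set Z : Finset ℝ := (Finset.range (3 * F.card + 1)).image (fun i : ℕ => (i : ℝ)) with hZ
    have hZcard : Z.card = 3 * F.card + 1 := by
      rw [hZ, Finset.card_image_of_injective _ Nat.cast_injective, Finset.card_range]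
    have hle := extSum_card_zeros_le (3 * F.card) F P hne hslots Z (fun z _ => hrep z)
    omega
  intro p₀ q₀
  have hcoeff : (P (δ0 p₀ + δ0 q₀)).coeff (d p₀ + d q₀)
      = ∑ p : Fin 6, ∑ q : Fin 6, if (δ0 p + δ0 q = δ0 p₀ + δ0 q₀ ∧ d p + d q = d p₀ + d q₀)
          then polar (W p) (W q) else 0 := by
    rw [hP]
    simp only [finsetSum_coeff]
    refine Finset.sum_congr rfl fun p _ => Finset.sum_congr rfl fun q _ => ?_
    by_cases hval : δ0 p + δ0 q = δ0 p₀ + δ0 q₀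
    · rw [if_pos hval, coeff_C_mul_X_pow]
      by_cases hdeq : d p₀ + d q₀ = d p + d q
      · rw [if_pos hdeq, if_pos ⟨hval, hdeq.symm⟩]
      · rw [if_neg hdeq, if_neg (fun h => hdeq h.2.symm)]
    · rw [if_neg hval, coeff_zero, if_neg (fun h => hval h.1)]
  have h0 : (P (δ0 p₀ + δ0 q₀)).coeff (d p₀ + d q₀) = 0 := by rw [hPzero _ (hmemF p₀ q₀), coeff_zero]
  rw [hcoeff] at h0
  refine Eq.trans ?_ h0
  refine Finset.sum_congr rfl fun p _ => Finset.sum_congr rfl fun q _ => ?_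
  exact if_congr (by rw [hv]) rfl rfl

/-! ## 2. Slot bookkeeping on the one-pair walls (integer models, decidable keys) -/

/-- **Integer model of the wall (a)** (`decide`): `v = ![0,1,9,3,7]` has `v 1 + v 2 = v 3 + v 4` and no other coincidence. [folklore] -/
theorem fiveA_model (v : Fin 5 → ℕ) (hvd : v = ![0, 1, 9, 3, 7]) :
    ∀ a b c e : Fin 5, v a + v b = v c + v e ↔
      ((a = c ∧ b = e) ∨ (a = e ∧ b = c) ∨
        (((a = 1 ∧ b = 2) ∨ (a = 2 ∧ b = 1)) ∧ ((c = 3 ∧ e = 4) ∨ (c = 4 ∧ e = 3))) ∨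
        (((a = 3 ∧ b = 4) ∨ (a = 4 ∧ b = 3)) ∧ ((c = 1 ∧ e = 2) ∨ (c = 2 ∧ e = 1)))) := by
  subst hvd
  decide

/-- **Lonely classes on the wall (a)** (`decide`): model `vv = ![0,1,9,3,7,0]`, degree `d = ![0,0,0,0,0,1]`; the only special class is
`{(1,2),(2,1),(3,4),(4,3)}`. [this work] -/
theorem onePairA_lonely (vv : Fin 6 → ℕ) (hvv : vv = ![0, 1, 9, 3, 7, 0]) (d : Fin 6 → ℕ) (hd : d = ![0, 0, 0, 0, 0, 1]) :
    ∀ p q p₀ q₀ : Fin 6, (vv p + vv q = vv p₀ + vv q₀ ∧ d p + d q = d p₀ + d q₀) →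
      ¬ ((p₀ = 1 ∧ q₀ = 2) ∨ (p₀ = 2 ∧ q₀ = 1) ∨ (p₀ = 3 ∧ q₀ = 4) ∨ (p₀ = 4 ∧ q₀ = 3)) →
      (p = p₀ ∧ q = q₀) ∨ (p = q₀ ∧ q = p₀) := by
  subst hvv hd
  intro p q p₀ q₀
  revert p q
  fin_cases p₀ <;> fin_cases q₀ <;> decide

/-- The model class of `(1,2)` on the wall (a) (`decide`). [this work] -/
theorem onePairA_special12_iff (vv : Fin 6 → ℕ) (hvv : vv = ![0, 1, 9, 3, 7, 0]) (d : Fin 6 → ℕ) (hd : d = ![0, 0, 0, 0, 0, 1]) :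
    ∀ p q : Fin 6, ((vv p + vv q = vv 1 + vv 2 ∧ d p + d q = d 1 + d 2) ↔
        ((p = 1 ∧ q = 2) ∨ (p = 2 ∧ q = 1) ∨ (p = 3 ∧ q = 4) ∨ (p = 4 ∧ q = 3))) := by
  subst hvv hd
  decide

/-- **Integer model of the wall (b)** (`decide`): `v = ![0,4,1,3,9]` has `v 0 + v 1 = v 2 + v 3` and no other coincidence. [folklore] -/
theorem fiveB_model (v : Fin 5 → ℕ) (hvd : v = ![0, 4, 1, 3, 9]) :
    ∀ a b c e : Fin 5, v a + v b = v c + v e ↔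
      ((a = c ∧ b = e) ∨ (a = e ∧ b = c) ∨
        (((a = 0 ∧ b = 1) ∨ (a = 1 ∧ b = 0)) ∧ ((c = 2 ∧ e = 3) ∨ (c = 3 ∧ e = 2))) ∨
        (((a = 2 ∧ b = 3) ∨ (a = 3 ∧ b = 2)) ∧ ((c = 0 ∧ e = 1) ∨ (c = 1 ∧ e = 0)))) := by
  subst hvd
  decide

/-- **Lonely classes on the wall (b)** (`decide`): model `vv = ![0,4,1,3,9,0]`; the only special class is `{(0,1),(1,0),(2,3),(3,2)}`. [this work] -/
theorem onePairB_lonely (vv : Fin 6 → ℕ) (hvv : vv = ![0, 4, 1, 3, 9, 0]) (d : Fin 6 → ℕ) (hd : d = ![0, 0, 0, 0, 0, 1]) :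
    ∀ p q p₀ q₀ : Fin 6, (vv p + vv q = vv p₀ + vv q₀ ∧ d p + d q = d p₀ + d q₀) →
      ¬ ((p₀ = 0 ∧ q₀ = 1) ∨ (p₀ = 1 ∧ q₀ = 0) ∨ (p₀ = 2 ∧ q₀ = 3) ∨ (p₀ = 3 ∧ q₀ = 2)) →
      (p = p₀ ∧ q = q₀) ∨ (p = q₀ ∧ q = p₀) := by
  subst hvv hd
  intro p q p₀ q₀
  revert p q
  fin_cases p₀ <;> fin_cases q₀ <;> decide

/-- The model class of `(0,1)` on the wall (b) (`decide`). [this work] -/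
theorem onePairB_special01_iff (vv : Fin 6 → ℕ) (hvv : vv = ![0, 4, 1, 3, 9, 0]) (d : Fin 6 → ℕ) (hd : d = ![0, 0, 0, 0, 0, 1]) :
    ∀ p q : Fin 6, ((vv p + vv q = vv 0 + vv 1 ∧ d p + d q = d 0 + d 1) ↔
        ((p = 0 ∧ q = 1) ∨ (p = 1 ∧ q = 0) ∨ (p = 2 ∧ q = 3) ∨ (p = 3 ∧ q = 2))) := by
  subst hvv hd
  decide

/-! ## 3. Non-degeneracy on the one-pair walls -/

/-- **NON-DEGENERACY OF THE CONFLUENT LIMIT ON THE WALL (a)** `δ0 1 + δ0 2 = δ0 3 + δ0 4` (one Weyl pair at `0,5`; `hgen`: no other coincidence among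
the pair sums of the five values `δ0 0, …, δ0 4`). [this work] -/
theorem confluentDet_ne_zero_of_polar_ne_zero_wallA (δ0 : Fin 6 → ℝ) (h05 : δ0 5 = δ0 0)
    (hrel : δ0 1 + δ0 2 = δ0 3 + δ0 4)
    (hgen : ∀ a b c e : Fin 5, δ0 a.castSucc + δ0 b.castSucc = δ0 c.castSucc + δ0 e.castSucc →
      (a = c ∧ b = e) ∨ (a = e ∧ b = c) ∨
        (((a = 1 ∧ b = 2) ∨ (a = 2 ∧ b = 1)) ∧ ((c = 3 ∧ e = 4) ∨ (c = 4 ∧ e = 3))) ∨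
        (((a = 3 ∧ b = 4) ∨ (a = 4 ∧ b = 3)) ∧ ((c = 1 ∧ e = 2) ∨ (c = 2 ∧ e = 1))))
    (W : Fin 6 → Matrix (Fin 2) (Fin 2) ℝ) (hWs : ∀ l, (W l).IsSymm) (hW : ∃ p q, polar (W p) (W q) ≠ 0) :
    ∃ t, ((Real.exp (δ0 0 * t)) • (W 0 + t • W 5) + ∑ k : Fin 4, (Real.exp (δ0 k.succ.castSucc * t)) • W k.succ.castSucc).det ≠ 0 := by
  classical
  by_contra hall
  push Not at hall
  set ρ : Fin 6 → Fin 5 := ![0, 1, 2, 3, 4, 0] with hρdef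
  set v : Fin 5 → ℕ := ![0, 1, 9, 3, 7] with hvd
  set vv : Fin 6 → ℕ := ![0, 1, 9, 3, 7, 0] with hvvd
  set dg : Fin 6 → ℕ := ![0, 0, 0, 0, 0, 1] with hdgdef
  have hρ : ∀ l : Fin 6, δ0 l = δ0 (ρ l).castSucc := by
    intro l
    fin_cases l
    · rfl
    · rfl
    · rfl
    · rfl
    · rfl
    · exact h05
  have hvvρ : ∀ l : Fin 6, vv l = v (ρ l) := by intro l; fin_cases l <;> rfl
  have hmodel := fiveA_model v hvd
  have h1 : δ0 (Fin.castSucc (1 : Fin 5)) = δ0 1 := rfl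
  have h2 : δ0 (Fin.castSucc (2 : Fin 5)) = δ0 2 := rfl
  have h3 : δ0 (Fin.castSucc (3 : Fin 5)) = δ0 3 := rfl
  have h4 : δ0 (Fin.castSucc (4 : Fin 5)) = δ0 4 := rfl
  have hv : ∀ p q p₀ q₀ : Fin 6, δ0 p + δ0 q = δ0 p₀ + δ0 q₀ ↔ vv p + vv q = vv p₀ + vv q₀ := by
    intro p q p₀ q₀
    rw [hρ p, hρ q, hρ p₀, hρ q₀, hvvρ p, hvvρ q, hvvρ p₀, hvvρ q₀, hmodel]
    constructor
    · exact hgen _ _ _ _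
    · rintro (⟨ha, hb⟩ | ⟨ha, hb⟩ | ⟨(⟨ha, hb⟩ | ⟨ha, hb⟩), (⟨hc, he⟩ | ⟨hc, he⟩)⟩ | ⟨(⟨ha, hb⟩ | ⟨ha, hb⟩), (⟨hc, he⟩ | ⟨hc, he⟩)⟩)
      · rw [ha, hb]
      · rw [ha, hb, add_comm]
      all_goals
        rw [ha, hb, hc, he]
        simp only [h1, h2, h3, h4]
        linarith [hrel]
  have hσ := onePair_classSums_of_det_zero δ0 h05 vv hv dg hdgdef W hall
  have hzero : ∀ p₀ q₀ : Fin 6, ¬ ((p₀ = 1 ∧ q₀ = 2) ∨ (p₀ = 2 ∧ q₀ = 1) ∨ (p₀ = 3 ∧ q₀ = 4) ∨ (p₀ = 4 ∧ q₀ = 3)) →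
      polar (W p₀) (W q₀) = 0 := by
    intro p₀ q₀ hsp
    refine polar_eq_zero_of_lonely_classSum W p₀ q₀
      (fun p q => (vv p + vv q = vv p₀ + vv q₀ ∧ dg p + dg q = dg p₀ + dg q₀)) ?_ (hσ p₀ q₀)
    intro p q
    constructor
    · exact fun hk => onePairA_lonely vv hvvd dg hdgdef p q p₀ q₀ hk hsp
    · rintro (⟨rfl, rfl⟩ | ⟨rfl, rfl⟩)
      · exact ⟨rfl, rfl⟩
      · exact ⟨add_comm _ _, add_comm _ _⟩
  set y : ℝ := polar (W 1) (W 2) with hy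
  have hrely : polar (W 3) (W 4) = -y := by
    have h := hσ 1 2
    simp only [onePairA_special12_iff vv hvvd dg hdgdef] at h
    simp [Fin.sum_univ_six] at h
    linarith [h, polar_comm (W 2) (W 1), polar_comm (W 4) (W 3)]
  have hentry : ∀ a b : Fin 6, polar (W a) (W b)
      = y * ((if a = 1 ∧ b = 2 then (1 : ℝ) else 0) + (if a = 2 ∧ b = 1 then 1 else 0)
          - (if a = 3 ∧ b = 4 then 1 else 0) - (if a = 4 ∧ b = 3 then 1 else 0)) := by
    intro a b
    by_cases hs : (a = 1 ∧ b = 2) ∨ (a = 2 ∧ b = 1) ∨ (a = 3 ∧ b = 4) ∨ (a = 4 ∧ b = 3)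
    · rcases hs with ⟨rfl, rfl⟩ | ⟨rfl, rfl⟩ | ⟨rfl, rfl⟩ | ⟨rfl, rfl⟩
      · simpa using hy.symm
      · rw [polar_comm]; simpa using hy.symm
      · simp [hrely]
      · rw [polar_comm]; simp [hrely]
    · rw [hzero a b hs]
      simp only [not_or] at hs
      obtain ⟨h1, h2, h3, h4⟩ := hs
      rw [if_neg h1, if_neg h2, if_neg h3, if_neg h4]; ring
  have hy0 : y ≠ 0 := by
    intro hy0
    obtain ⟨p, q, hpq⟩ := hW
    exact hpq (by rw [hentry p q, hy0, zero_mul])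
  have hreal : Realisable (Matrix.of fun a b : Fin 6 =>
      (if a = 1 ∧ b = 2 then (1 : ℝ) else 0) + (if a = 2 ∧ b = 1 then 1 else 0)
        - (if a = 3 ∧ b = 4 then 1 else 0) - (if a = 4 ∧ b = 3 then 1 else 0)) := by
    have hG := realisable_smul y⁻¹ (realisable_polarGram W hWs)
    convert hG using 1
    ext a b
    rw [Matrix.smul_apply, Matrix.of_apply, Matrix.of_apply, hentry a b, smul_eq_mul, ← mul_assoc, inv_mul_cancel₀ hy0, one_mul]
  exact not_realisable_disjointPattern 1 2 3 4 (by decide) (by decide) (by decide) (by decide) (by decide) (by decide) hreal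

/-- **NON-DEGENERACY OF THE CONFLUENT LIMIT ON THE WALL (b)** `δ0 0 + δ0 1 = δ0 2 + δ0 3` (the relation passes through the Weyl value `δ0 0 = δ0 5`;
`hgen`: no other coincidence among the pair sums of the five values). [this work] -/
theorem confluentDet_ne_zero_of_polar_ne_zero_wallB (δ0 : Fin 6 → ℝ) (h05 : δ0 5 = δ0 0)
    (hrel : δ0 0 + δ0 1 = δ0 2 + δ0 3)
    (hgen : ∀ a b c e : Fin 5, δ0 a.castSucc + δ0 b.castSucc = δ0 c.castSucc + δ0 e.castSucc →
      (a = c ∧ b = e) ∨ (a = e ∧ b = c) ∨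
        (((a = 0 ∧ b = 1) ∨ (a = 1 ∧ b = 0)) ∧ ((c = 2 ∧ e = 3) ∨ (c = 3 ∧ e = 2))) ∨
        (((a = 2 ∧ b = 3) ∨ (a = 3 ∧ b = 2)) ∧ ((c = 0 ∧ e = 1) ∨ (c = 1 ∧ e = 0))))
    (W : Fin 6 → Matrix (Fin 2) (Fin 2) ℝ) (hWs : ∀ l, (W l).IsSymm) (hW : ∃ p q, polar (W p) (W q) ≠ 0) :
    ∃ t, ((Real.exp (δ0 0 * t)) • (W 0 + t • W 5) + ∑ k : Fin 4, (Real.exp (δ0 k.succ.castSucc * t)) • W k.succ.castSucc).det ≠ 0 := by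
  classical
  by_contra hall
  push Not at hall
  set ρ : Fin 6 → Fin 5 := ![0, 1, 2, 3, 4, 0] with hρdef
  set v : Fin 5 → ℕ := ![0, 4, 1, 3, 9] with hvd
  set vv : Fin 6 → ℕ := ![0, 4, 1, 3, 9, 0] with hvvd
  set dg : Fin 6 → ℕ := ![0, 0, 0, 0, 0, 1] with hdgdef
  have hρ : ∀ l : Fin 6, δ0 l = δ0 (ρ l).castSucc := by
    intro l
    fin_cases l
    · rfl
    · rfl
    · rfl
    · rfl
    · rfl
    · exact h05
  have hvvρ : ∀ l : Fin 6, vv l = v (ρ l) := by intro l; fin_cases l <;> rfl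
  have hmodel := fiveB_model v hvd
  have h0 : δ0 (Fin.castSucc (0 : Fin 5)) = δ0 0 := rfl
  have h1 : δ0 (Fin.castSucc (1 : Fin 5)) = δ0 1 := rfl
  have h2 : δ0 (Fin.castSucc (2 : Fin 5)) = δ0 2 := rfl
  have h3 : δ0 (Fin.castSucc (3 : Fin 5)) = δ0 3 := rfl
  have hv : ∀ p q p₀ q₀ : Fin 6, δ0 p + δ0 q = δ0 p₀ + δ0 q₀ ↔ vv p + vv q = vv p₀ + vv q₀ := by
    intro p q p₀ q₀
    rw [hρ p, hρ q, hρ p₀, hρ q₀, hvvρ p, hvvρ q, hvvρ p₀, hvvρ q₀, hmodel]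
    constructor
    · exact hgen _ _ _ _
    · rintro (⟨ha, hb⟩ | ⟨ha, hb⟩ | ⟨(⟨ha, hb⟩ | ⟨ha, hb⟩), (⟨hc, he⟩ | ⟨hc, he⟩)⟩ | ⟨(⟨ha, hb⟩ | ⟨ha, hb⟩), (⟨hc, he⟩ | ⟨hc, he⟩)⟩)
      · rw [ha, hb]
      · rw [ha, hb, add_comm]
      all_goals
        rw [ha, hb, hc, he]
        simp only [h0, h1, h2, h3]
        linarith [hrel]
  have hσ := onePair_classSums_of_det_zero δ0 h05 vv hv dg hdgdef W hall
  have hzero : ∀ p₀ q₀ : Fin 6, ¬ ((p₀ = 0 ∧ q₀ = 1) ∨ (p₀ = 1 ∧ q₀ = 0) ∨ (p₀ = 2 ∧ q₀ = 3) ∨ (p₀ = 3 ∧ q₀ = 2)) →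
      polar (W p₀) (W q₀) = 0 := by
    intro p₀ q₀ hsp
    refine polar_eq_zero_of_lonely_classSum W p₀ q₀
      (fun p q => (vv p + vv q = vv p₀ + vv q₀ ∧ dg p + dg q = dg p₀ + dg q₀)) ?_ (hσ p₀ q₀)
    intro p q
    constructor
    · exact fun hk => onePairB_lonely vv hvvd dg hdgdef p q p₀ q₀ hk hsp
    · rintro (⟨rfl, rfl⟩ | ⟨rfl, rfl⟩)
      · exact ⟨rfl, rfl⟩
      · exact ⟨add_comm _ _, add_comm _ _⟩
  set y : ℝ := polar (W 0) (W 1) with hy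
  have hrely : polar (W 2) (W 3) = -y := by
    have h := hσ 0 1
    simp only [onePairB_special01_iff vv hvvd dg hdgdef] at h
    simp [Fin.sum_univ_six] at h
    linarith [h, polar_comm (W 1) (W 0), polar_comm (W 3) (W 2)]
  have hentry : ∀ a b : Fin 6, polar (W a) (W b)
      = y * ((if a = 0 ∧ b = 1 then (1 : ℝ) else 0) + (if a = 1 ∧ b = 0 then 1 else 0)
          - (if a = 2 ∧ b = 3 then 1 else 0) - (if a = 3 ∧ b = 2 then 1 else 0)) := by
    intro a b
    by_cases hs : (a = 0 ∧ b = 1) ∨ (a = 1 ∧ b = 0) ∨ (a = 2 ∧ b = 3) ∨ (a = 3 ∧ b = 2)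
    · rcases hs with ⟨rfl, rfl⟩ | ⟨rfl, rfl⟩ | ⟨rfl, rfl⟩ | ⟨rfl, rfl⟩
      · simpa using hy.symm
      · rw [polar_comm]; simpa using hy.symm
      · simp [hrely]
      · rw [polar_comm]; simp [hrely]
    · rw [hzero a b hs]
      simp only [not_or] at hs
      obtain ⟨h1, h2, h3, h4⟩ := hs
      rw [if_neg h1, if_neg h2, if_neg h3, if_neg h4]; ring
  have hy0 : y ≠ 0 := by
    intro hy0
    obtain ⟨p, q, hpq⟩ := hW
    exact hpq (by rw [hentry p q, hy0, zero_mul])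
  have hreal : Realisable (Matrix.of fun a b : Fin 6 =>
      (if a = 0 ∧ b = 1 then (1 : ℝ) else 0) + (if a = 1 ∧ b = 0 then 1 else 0)
        - (if a = 2 ∧ b = 3 then 1 else 0) - (if a = 3 ∧ b = 2 then 1 else 0)) := by
    have hG := realisable_smul y⁻¹ (realisable_polarGram W hWs)
    convert hG using 1
    ext a b
    rw [Matrix.smul_apply, Matrix.of_apply, Matrix.of_apply, hentry a b, smul_eq_mul, ← mul_assoc, inv_mul_cancel₀ hy0, one_mul]
  exact not_realisable_disjointPattern 0 1 2 3 (by decide) (by decide) (by decide) (by decide) (by decide) (by decide) hreal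

end Summit.ValiantsHypothesis.ValiantsHypothesis.Theorems.LacunarySymmetroidMatrixDescartes.WallBubbling
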